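import Mathlib
import Summits.MatrixMultiplication.MatrixMultiplication.Theses.NilpotentLieHosts
import Summits.MatrixMultiplication.MatrixMultiplication.Theorems.NilpotentLieHostsDesignsGiveTarget
import Summits.MatrixMultiplication.MatrixMultiplication.Theorems.NilpotentLieHostsObstructionKillsHeisenberg

/-!
# `NilpotentThresholdDesigns` (stmt-MatrixMultiplication-7720) IS the disjunction of the two design cruxes

Route `NilpotentLieHosts`, crux #0 `NilpotentThresholdDesigns` (`∃ d ≥ 3, …`).  The route files the `d = 3` case as
its own crux `HeisenbergThresholdDesigns` (stmt-7721) and the `d ≥ 4` case as `HigherStepThresholdDesigns` (stmt-7725),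
and the landed support item `DesignsGiveTarget` (stmt-7729, `designsGiveTarget_proof`) is the implication
`(7721 ∨ 7725) → 7720`.  This file records the converse split `d = 3 ∨ 4 ≤ d` and hence the EQUIVALENCE

  `NilpotentThresholdDesigns ↔ HeisenbergThresholdDesigns ∨ HigherStepThresholdDesigns`,

together with its two bookkeeping corollaries used by the line lead of the crux:

* the crux is refuted exactly when BOTH design cruxes are (`not_nilpotentThresholdDesigns_iff`);
* under the route's staffed negative crux `HeisenbergThresholdObstruction` (stmt-7723, which kills the `d = 3` branch by
  the landed `obstructionKillsHeisenberg_proof`) the crux is literally `HigherStepThresholdDesigns`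
  (`nilpotentThresholdDesigns_iff_higherStep_of_obstruction`).

Pure quantifier bookkeeping (the only arithmetic is `(3/4)·3·(3−1) = 9/2`); it makes formal that the crux has no content
beyond items 7721/7725 and names the one item it hinges on once 7723 lands.

Reference for the shared notion of separating polynomials: J. Blasiak, H. Cohn, J. A. Grochow, K. Pratt, C. Umans,
*Finite matrix multiplication algorithms from infinite groups*, arXiv:2410.14905 (2024), Def 2.1.
-/

set_option linter.dupNamespace false

namespace Summit.MatrixMultiplication.MatrixMultiplication.Theorems.NilpotentThresholdDesigns

open Summit.MatrixMultiplication.MatrixMultiplication.Theses.NilpotentLieHosts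

/-- **The crux is the disjunction of the two design cruxes.**
`NilpotentThresholdDesigns ↔ HeisenbergThresholdDesigns ∨ HigherStepThresholdDesigns`: a witness `d ≥ 3` has `d = 3`
(the Heisenberg crux, threshold exponent `(3/4)·3·2 = 9/2`) or `d ≥ 4` (the higher-step crux, verbatim body); the
converse is the landed `designsGiveTarget_proof`. [cite: BlasiakCohnGrochowPrattUmans2024, Def 2.1] -/
theorem nilpotentThresholdDesigns_iff_heisenberg_or_higherStep : Summit.MatrixMultiplication.MatrixMultiplication.Theses.NilpotentLieHosts.NilpotentThresholdDesigns ↔ (Summit.MatrixMultiplication.MatrixMultiplication.Theses.NilpotentLieHosts.HeisenbergThresholdDesigns ∨ Summit.MatrixMultiplication.MatrixMultiplication.Theses.NilpotentLieHosts.HigherStepThresholdDesigns) := by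
  refine ⟨fun h => ?_, designsGiveTarget_proof⟩
  unfold NilpotentThresholdDesigns at h
  obtain ⟨d, hd3, h⟩ := h
  rcases Nat.lt_or_ge d 4 with hlt | hge
  · -- `d = 3`: the Heisenberg crux
    left
    obtain rfl : d = 3 := le_antisymm (Nat.lt_succ_iff.mp hlt) hd3
    unfold HeisenbergThresholdDesigns
    intro δ hδ s₀
    obtain ⟨s, hs, X, Y, Z, hU, hT, hSep, hV⟩ := h δ hδ s₀
    refine ⟨s, hs, X, Y, Z, hU, hT, hSep, ?_⟩
    have hexp : (3 : ℝ) / 4 * ((3 : ℕ) : ℝ) * (((3 : ℕ) : ℝ) - 1) - δ = (9 : ℝ) / 2 - δ := by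
      norm_num
    rw [hexp] at hV
    exact hV
  · -- `d ≥ 4`: the higher-step crux, verbatim
    right
    exact ⟨d, hge, h⟩

/-- **Refutation bookkeeping.** The crux `NilpotentThresholdDesigns` is false exactly when both design cruxes are:
`¬ NilpotentThresholdDesigns ↔ ¬ HeisenbergThresholdDesigns ∧ ¬ HigherStepThresholdDesigns`.
[cite: BlasiakCohnGrochowPrattUmans2024, Def 2.1] -/
theorem not_nilpotentThresholdDesigns_iff :
    ¬ NilpotentThresholdDesigns ↔ (¬ HeisenbergThresholdDesigns ∧ ¬ HigherStepThresholdDesigns) := by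
  rw [nilpotentThresholdDesigns_iff_heisenberg_or_higherStep, not_or]

/-- **What the crux hinges on once the Heisenberg obstruction lands.** Under the route's negative crux
`HeisenbergThresholdObstruction` (a power saving `|X||Y||Z| ≤ C (s+1)^(9/2 − c)` in `U_3(ℤ)`, which refutes the
`d = 3` branch by the landed `obstructionKillsHeisenberg_proof`), the crux is equivalent to the higher-step design
crux: `NilpotentThresholdDesigns ↔ HigherStepThresholdDesigns`. [cite: BlasiakCohnGrochowPrattUmans2024, Def 2.1] -/
theorem nilpotentThresholdDesigns_iff_higherStep_of_obstruction (hObs : HeisenbergThresholdObstruction) :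
    NilpotentThresholdDesigns ↔ HigherStepThresholdDesigns := by
  have hnotH : ¬ HeisenbergThresholdDesigns := obstructionKillsHeisenberg_proof hObs
  rw [nilpotentThresholdDesigns_iff_heisenberg_or_higherStep]
  exact ⟨fun h => h.resolve_left hnotH, Or.inr⟩

end Summit.MatrixMultiplication.MatrixMultiplication.Theorems.NilpotentThresholdDesigns
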